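import Summits.Ventures.CertifiedManyBodySolver.Upper.DWaveSourceOpenClusterCapTTPrime
import Summits.Ventures.CertifiedManyBodySolver.Observables.PinningFieldChords
import HarnessLib

/-!
# PINNING-FIELD chords, part 5: readers from an open `t–t'` cluster CAP certificate to the response leaves
# (general `tp`; the cuprate anchor `t' = −1/4`)

HONEST FRAMING: first certified bounds; not a superconductivity verdict; every number certified or
labelled float. Soundness wrappers only; no number is claimed here. A finite-`h` response FLOOR is an
instrument statement (large-field response), NOT an order parameter and NOT a phase word; a ceiling never
speaks to presence.

The `t–t'` twin of `Observables/PinningFieldClusterCapReaders.lean` (seat hubbard-obs-pin-1): the producer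
`sourcedEnergyUpperRow_of_exists_clusterStateTT'` (`Upper/DWaveSourceOpenClusterCapTTPrime.lean`: an even unit vector of the
open `t–t'` sourced `a × b` cluster `dWaveSourceOpenBoxTT' a b tp U μ h` with `Re⟨φ, A^{tt'}_C φ⟩ ≤ hi·(ab)` ⇒
`SourcedEnergyUpperRow tp U μ h q L₁ hi`) composed with the chord leaves of `Observables/PinningFieldChords.lean`
(generic `tp`):

* `PinFieldResponseFloorAt.of_sourcedLower_of_clusterCapTT'` — FLOOR leaf at `h` from a sourced floor row at `h₁ < h`
  (any `q₀ ∣ q`) and a `t–t'` cluster cap AT `h`: `m·2(h − h₁) ≤ lo − hi`;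
* `PinFieldResponseCeilingAt.of_clusterCapTT'_of_sourcedLower` — CEILING leaf at `h` from the cap AT `h` and a sourced
  floor at `h₂ > h`;
* the `4 × 3` instances (`q = L₁ = 12`).

References: T. Koma, H. Tasaki, J. Stat. Phys. 76 (1994) 745, §1; H. Xu et al., Science 384 (2024) eadh7691, eq. (1).
Tree: `PinFieldResponseFloorAt.of_energyRows`, `PinFieldResponseCeilingAt.of_energyRows`, `SourcedEnergyLowerRow.mono`.
-/

noncomputable section

namespace Summit.Ventures.CertifiedManyBodySolver

open Matrix Literature.MathematicalPhysics.QuantumLattice Literature.MathematicalPhysics.QuantumLattice.TwoCluster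
open Summit.Ventures.CertifiedManyBodySolver.Observables
open scoped ComplexOrder

variable {a b q L₀ L₁ : ℕ} {tp U μ : ℝ}

/-- **FLOOR leaf (general `tp`) from a sourced floor row at `h₁ < h` and an open `t–t'` cluster cap AT `h`.**
Slot: `m · 2(h − h₁) ≤ lo − hi`. [cite: KomaTasaki1994, §1] -/
theorem PinFieldResponseFloorAt.of_sourcedLower_of_clusterCapTT' {q₀ : ℕ} {h₁ h : ℝ} (hlt : h₁ < h) {lo hi m : ℚ}
    (hlo : SourcedEnergyLowerRow tp U μ h₁ q₀ L₀ lo) (hq₀ : q₀ ∣ q) (hqa : a ∣ q) (hqb : b ∣ q) (hLa : a < L₁)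
    (hLb : b < L₁)
    (hcap : ∃ φ : Fock (Orb (Fin a ×ₗ Fin b)), HasParity 0 φ ∧ star φ ⬝ᵥ φ = 1 ∧
      (star φ ⬝ᵥ (dWaveSourceOpenBoxTT' a b tp U μ h *ᵥ φ)).re ≤ ((hi : ℚ) : ℝ) * ((a : ℝ) * b))
    (hm : ((m : ℚ) : ℝ) * (2 * (h - h₁)) ≤ lo - hi) :
    PinFieldResponseFloorAt tp U μ h q (max L₀ L₁) m :=
  PinFieldResponseFloorAt.of_energyRows hlt (hlo.mono le_rfl le_rfl hq₀)
    (sourcedEnergyUpperRow_of_exists_clusterStateTT' hqa hqb hLa hLb tp U μ h hcap) hm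

/-- **CEILING leaf (general `tp`) from an open `t–t'` cluster cap AT `h` and a sourced floor row at `h₂ > h`.**
Slot: `hi − lo ≤ M · 2(h₂ − h)`. A ceiling; never speaks to presence. [cite: KomaTasaki1994, §1] -/
theorem PinFieldResponseCeilingAt.of_clusterCapTT'_of_sourcedLower {q₀ : ℕ} {h h₂ : ℝ} (hlt : h < h₂) {hi lo M : ℚ}
    (hqa : a ∣ q) (hqb : b ∣ q) (hLa : a < L₁) (hLb : b < L₁)
    (hcap : ∃ φ : Fock (Orb (Fin a ×ₗ Fin b)), HasParity 0 φ ∧ star φ ⬝ᵥ φ = 1 ∧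
      (star φ ⬝ᵥ (dWaveSourceOpenBoxTT' a b tp U μ h *ᵥ φ)).re ≤ ((hi : ℚ) : ℝ) * ((a : ℝ) * b))
    (hlo : SourcedEnergyLowerRow tp U μ h₂ q₀ L₀ lo) (hq₀ : q₀ ∣ q)
    (hM : ((hi : ℚ) : ℝ) - lo ≤ ((M : ℚ) : ℝ) * (2 * (h₂ - h))) :
    PinFieldResponseCeilingAt tp U μ h q (max L₁ L₀) M :=
  PinFieldResponseCeilingAt.of_energyRows hlt (sourcedEnergyUpperRow_of_exists_clusterStateTT' hqa hqb hLa hLb tp U μ h hcap)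
    (hlo.mono le_rfl le_rfl hq₀) hM

/-- **The `4 × 3` FLOOR instance at general `tp`** (`q = L₁ = 12`; a translation-invariant sourced floor row
`q₀ = 1` at `h₁`). [cite: KomaTasaki1994, §1] -/
theorem PinFieldResponseFloorAt.of_sourcedLower_of_clusterCapTT'_4x3 {h₁ h : ℝ} (hlt : h₁ < h) {lo hi m : ℚ}
    (hlo : SourcedEnergyLowerRow tp U μ h₁ 1 L₀ lo)
    (hcap : ∃ φ : Fock (Orb (Fin 4 ×ₗ Fin 3)), HasParity 0 φ ∧ star φ ⬝ᵥ φ = 1 ∧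
      (star φ ⬝ᵥ (dWaveSourceOpenBoxTT' 4 3 tp U μ h *ᵥ φ)).re ≤ ((hi : ℚ) : ℝ) * ((4 : ℕ) * ((3 : ℕ) : ℝ)))
    (hm : ((m : ℚ) : ℝ) * (2 * (h - h₁)) ≤ lo - hi) :
    PinFieldResponseFloorAt tp U μ h 12 (max L₀ 12) m :=
  PinFieldResponseFloorAt.of_sourcedLower_of_clusterCapTT' hlt hlo (one_dvd _) (by norm_num) (by norm_num)
    (by norm_num) (by norm_num) hcap hm

/-- **The `4 × 3` CEILING instance at general `tp`**: cap AT `h`, translation-invariant sourced floor at `h₂ > h`.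
[cite: KomaTasaki1994, §1] -/
theorem PinFieldResponseCeilingAt.of_clusterCapTT'_of_sourcedLower_4x3 {h h₂ : ℝ} (hlt : h < h₂) {hi lo M : ℚ}
    (hcap : ∃ φ : Fock (Orb (Fin 4 ×ₗ Fin 3)), HasParity 0 φ ∧ star φ ⬝ᵥ φ = 1 ∧
      (star φ ⬝ᵥ (dWaveSourceOpenBoxTT' 4 3 tp U μ h *ᵥ φ)).re ≤ ((hi : ℚ) : ℝ) * ((4 : ℕ) * ((3 : ℕ) : ℝ)))
    (hlo : SourcedEnergyLowerRow tp U μ h₂ 1 L₀ lo)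
    (hM : ((hi : ℚ) : ℝ) - lo ≤ ((M : ℚ) : ℝ) * (2 * (h₂ - h))) :
    PinFieldResponseCeilingAt tp U μ h 12 (max 12 L₀) M :=
  PinFieldResponseCeilingAt.of_clusterCapTT'_of_sourcedLower hlt (by norm_num) (by norm_num) (by norm_num)
    (by norm_num) hcap hlo (one_dvd _) hM

end Summit.Ventures.CertifiedManyBodySolver

end
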